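import Summits.BirchSwinnertonDyer.BirchSwinnertonDyer.Theorems.Rank2Observatory2DescClFieldCertSSQ
import HarnessLib

/-!
# BirchSwinnertonDyer — rank ≥ 2 observatory: KERNEL-2DESC-CL v3.0, SSQ2 — SPLIT-2 PER-CURVE RECORDS AND CHECKERS OVER A TOTALLY SPLIT `q` (totally real)

HONEST FRAMING: per-curve certified theorems and census instruments; no claim on BSD in rank ≥ 2.

Second generic file of the «SSQ» variant: the per-curve RECORDS and the computable CHECKERS of the split-2
(S-type) instrument over a totally split auxiliary prime `(q) = W_0 W_1 W_2` in a totally real (cyclic) cubic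
field — the landed `…ClCurveCertSDefs` / `…ClRealCurveCertSDefs` texts with the three-prime data of SQ3
(`…ClCurveCertE2SQDefs`):
* `FamEntryS3` = `FamEntryS` + carrier index `c : Fin 3` (`e = ord_{W_c}(x)`, read on the `q`-part of `|N(X)|`)
  + two `invCert` data (`X ∉ W_{c+1}, W_{c+2}`);
* `ClCurveCertS3` = `ClCurveCertS` with THREE `invCert` data `X_D ∉ W_0, W_1, W_2` and `FamEntryS3` lists (head of
  SIX field-level elements `−1, ε₁, ε₂, γ_0, γ_1, q`); `ClCurveCertS3R` adds the sign tables at `ρ₁, ρ₂` and the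
  `θ_E`-order of the places (as `ClCurveCertSR`);
* checkers `famS3`, `primeDispatchS3`, `codeClauseS3`, `famKindCheckS3`, `famCheckS3`, `famL3S`, `famNormS3`,
  `famCheckS3R`, `sgAtS3`, `bitRowRS3` (rows `0,1,2` signs, `3,4,5` parities of `ord_{W_i}`, `6 + i` Euler bits),
  `bitRS3` (`chars.length + 6` rows), the sieve `admRS3`, and **`checkRS3Core`** = every clause of the landed
  `checkRS` except the survivor count (the count, with an extra sieve conjunct, is taken by the consumers — SSQ4
  `rank_le_of_checkRS3X`, SSQ5 `checkRS3N`);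
* entry-level lemmas `famCheckS3_of_famCheckS3R`, `sgAtS3_iff_of_famCheckS3R`, `rho_ne_zero_of_famCheckS3R`
  (the landed proofs; `frac_of_famCheckS3` is proved here for them).
New declarations only (`missAt`, `fracOf`, `sign_iff_eltS_of_signCond`, `rho_eltS_ne_zero_of_signCond` reused by name).
Sorry-free; axioms `propext`, `Classical.choice`, `Quot.sound`.
[cite: Cassels1991LecturesEllipticCurves, §15] [cite: Cohen1993, §4.8.2]
-/

set_option linter.dupNamespace false

noncomputable section

open scoped Classical NumberField nonZeroDivisors

open Literature.NumberTheory.NumberFields Polynomial Module NumberField IsDedekindDomain Ideal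

namespace Summit.BirchSwinnertonDyer.BirchSwinnertonDyer.Rank2Observatory.TwoDescCl

open TwoDescCubic ClFieldCert

/-! ## Records -/

/-- **A split-2 family entry over a totally split `q`**: `kind` (`1` = the element `q`, anything else generic),
`X = m₁x` in `α`-coordinates, the characteristic polynomial `(T, S, N)` of `x`, the sign bit at `ρ₀`, the index
`c` of the prime above `q` carrying `x`, `e = ord_{W_c}(x)`, the `invCert` data at `W_{c+1}`, `W_{c+2}`, the
factorisation `nf` of `|N(X)|`, the `α`-view exclusions, and the exclusions at the primes above `2`. Pure data. -/
structure FamEntryS3 where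
  /-- `1` = the element `q`; otherwise generic -/
  kind : ℕ
  /-- `m₁ · x` in `α`-coordinates -/
  X : ℤ × ℤ × ℤ
  /-- `(T, S, N)`: `x³ − T x² + S x − N = 0` -/
  tsn : ℤ × ℤ × ℤ
  /-- sign bit at the real place `ρ₀` (`true` = negative) -/
  sg : Bool
  /-- the index of the prime above `q` carrying `x` -/
  c : Fin 3
  /-- `ord_{W_c}(x)` -/
  e : ℕ
  /-- `invCert` datum: `X ∉ W_{c+1}` -/
  inv2 : ℤ × ℤ × ℤ
  /-- `invCert` datum: `X ∉ W_{c+2}` -/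
  inv3 : ℤ × ℤ × ℤ
  /-- factorisation of `|N(X)|` -/
  nf : List (ℕ × ℕ)
  /-- `α`-view exclusions `(code, invCert datum)` -/
  invsA : List (PCode × (ℤ × ℤ × ℤ))
  /-- exclusions at the primes above `2`: `(i, s, t)` with `x − 1 = 2s + π_i t` -/
  miss2 : List (Fin 3 × FracElt × FracElt)

/-- **Split-2 per-curve certificate over a totally split `q`** for `y² = x³ + Ax² + Bx + C`: as the landed
`ClCurveCertS` with THREE `invCert` data `X_D ∉ W_0, W_1, W_2`, a head of SIX field-level elements
`−1, ε₁, ε₂, γ_0, γ_1, q`, and `FamEntryS3` entries. Pure data. [cite: Cassels1991LecturesEllipticCurves, §15] -/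
structure ClCurveCertS3 where
  /-- the model `(0, A, 0, B, C)` -/
  A : ℤ
  /-- the model -/
  B : ℤ
  /-- the model -/
  C : ℤ
  /-- irreducibility modulus for `X³ + AX² + BX + C` -/
  pF : ℕ
  /-- `m₁ · e` in `α`-coordinates -/
  Xt : ℤ × ℤ × ℤ
  /-- characteristic polynomial of `e` -/
  tsnT : ℤ × ℤ × ℤ
  /-- `m₁ · F′(e)` in `α`-coordinates -/
  XD : ℤ × ℤ × ℤ
  /-- characteristic polynomial of `F′(e)` -/
  tsnD : ℤ × ℤ × ℤ
  /-- factorisation of `|N(X_D)|` -/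
  dn : List (ℕ × ℕ)
  /-- `α`-view exclusions for `D` -/
  dinvA : List (PCode × (ℤ × ℤ × ℤ))
  /-- exclusions of `D` at primes above `2`: `(i, s, t)` with `D − 1 = 2s + π_i t` -/
  dmiss2 : List (Fin 3 × FracElt × FracElt)
  /-- memberships of `D` at the split support primes: `(i, s, t)` with `D = 2s + π_i t` -/
  dmem2 : List (Fin 3 × FracElt × FracElt)
  /-- `invCert` datum: `X_D ∉ W_0` -/
  dW0 : ℤ × ℤ × ℤ
  /-- `invCert` datum: `X_D ∉ W_1` -/
  dW1 : ℤ × ℤ × ℤ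
  /-- `invCert` datum: `X_D ∉ W_2` -/
  dW2 : ℤ × ℤ × ℤ
  /-- sieve moduli -/
  Q : List ℕ
  /-- the head of the family: `−1, ε₁, ε₂, γ_0, γ_1, q` (six entries) -/
  head : List FamEntryS3
  /-- the support codes, tagged (`true` = `α`-code, `false` = split prime `code.1`), each with its element -/
  codes : List ((Bool × PCode) × FamEntryS3)

/-- **Totally real split-2 per-curve record over a totally split `q`**: the curve record `cc`, the sign bits at
`ρ₁, ρ₂` of every family element keyed by its `α`-view coordinates `X`, and the `θ_E`-order of the places. -/
structure ClCurveCertS3R where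
  cc : ClCurveCertS3
  sgn : List ((ℤ × ℤ × ℤ) × Bool × Bool)
  o₀ : Fin 3
  o₁ : Fin 3
  o₂ : Fin 3

namespace ClCurveCertS3R

variable (ccr : ClCurveCertS3R)

/-- Sign bit at `ρ₁` of the element with `α`-view coordinates `X` (table lookup; `false` if absent). -/
def sg₂ (X : ℤ × ℤ × ℤ) : Bool :=
  match ccr.sgn.find? fun e => e.1 == X with
  | some e => e.2.1
  | none => false

/-- Sign bit at `ρ₂` of the element with `α`-view coordinates `X` (table lookup; `false` if absent). -/
def sg₃ (X : ℤ × ℤ × ℤ) : Bool :=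
  match ccr.sgn.find? fun e => e.1 == X with
  | some e => e.2.2
  | none => false

end ClCurveCertS3R

/-! ## The checkers -/

section Checkers

variable (F : ClFieldCertS2) (cc : ClCurveCertS3)

/-- The family: head entries then the code elements. -/
def famS3 : List FamEntryS3 := cc.head ++ cc.codes.map Prod.snd

/-- **Prime dispatch** (landed `primeDispatchS` over the new record): the rational prime `p` of a norm factorisation
is `q`, or has an `α`-row each of whose codes is a support code or misses the element (`invCert` on `X`), or is `2`
and each prime above `2` is a support code or misses the element (split witness). Computable. -/
def primeDispatchS3 (x : FracElt) (X : ℤ × ℤ × ℤ) (invsA : List (PCode × (ℤ × ℤ × ℤ)))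
    (miss2 : List (Fin 3 × FracElt × FracElt)) (p : ℕ) : Bool :=
  (p == F.fs.base.q) ||
    ((F.fs.base.primes.any fun e => e.p == p) &&
      ((F.fs.base.row p).codes.all fun C' => decide ((true, C') ∈ cc.codes.map Prod.fst) ||
        invsA.any fun ci => ci.1 == C' && invCert F.fs.base.a F.fs.base.b F.fs.base.c C' X ci.2)) ||
    ((p == 2) && decide (∀ i : Fin 3,
      (false, ((i : ℕ), (0 : ℤ), (0 : ℤ), (0 : ℤ))) ∈ cc.codes.map Prod.fst ∨ missAt F x miss2 i = true))

/-- **Support-code clause** (landed `codeClauseS` over the new record): an `α`-code is present in the registry and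
its prime contains `D` (`memCode`); a split code `i < 3` carries a membership witness `D = 2s + π_i t`. Computable. -/
def codeClauseS3 (bc : (Bool × PCode) × FamEntryS3) : Bool :=
  if bc.1.1 then
    (F.fs.base.primes.any fun e => e.p == bc.1.2.1) && decide (bc.1.2 ∈ (F.fs.base.row bc.1.2.1).codes) &&
      memCode bc.1.2 cc.XD
  else
    decide (bc.1.2 = (bc.1.2.1, 0, 0, 0)) &&
      cc.dmem2.any fun ws => decide ((ws.1 : ℕ) = bc.1.2.1) && (ws.2.1.check F.fs.base.a F.fs.base.b F.fs.base.c &&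
        (ws.2.2.check F.fs.base.a F.fs.base.b F.fs.base.c &&
          FracElt.linCheck F.fs.base.a F.fs.base.b F.fs.base.c 2 0 (fracOf F cc.XD cc.tsnD)
            (F.fs.split.pi ws.1) ws.2.1 ws.2.2))

/-- **Kind clause (split `q`)**: the element `q` is literally `X = (m₁ q, 0, 0)`; a generic element misses the two
primes `W_{c+1}`, `W_{c+2}` above `q` other than its carrier and has certified `ord_{W_c}` (the `q`-part of
`|N(X)|`, `q ∤ m₁`). Computable. -/
def famKindCheckS3 (f : FamEntryS3) : Bool :=
  if f.kind = 1 then decide (f.X = ((F.m₁ : ℤ) * F.fs.base.q, 0, 0))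
  else invCert F.fs.base.a F.fs.base.b F.fs.base.c (F.fs.base.wq (f.c + 1)) f.X f.inv2 &&
    invCert F.fs.base.a F.fs.base.b F.fs.base.c (F.fs.base.wq (f.c + 2)) f.X f.inv3 &&
    ordCheck F.fs.base.q (normFormZ F.fs.base.a F.fs.base.b F.fs.base.c f.X.1 f.X.2.1 f.X.2.2).natAbs f.e

/-- **The split-2 family-entry check over a totally split `q`** (landed clauses, split-`q` kind clause). Computable.
[cite: Cassels1991LecturesEllipticCurves, §15] -/
def famCheckS3 (f : FamEntryS3) : Bool :=
  (fracOf F f.X f.tsn).check F.fs.base.a F.fs.base.b F.fs.base.c &&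
    signCond F.fs.base.lo F.fs.base.hi f.X f.sg &&
    decide (normFormZ F.fs.base.a F.fs.base.b F.fs.base.c f.X.1 f.X.2.1 f.X.2.2 ≠ 0) &&
    decide (((F.m₁ : ℤ)) ^ 3 ∣ normFormZ F.fs.base.a F.fs.base.b F.fs.base.c f.X.1 f.X.2.1 f.X.2.2) &&
    (F.fs.base.chars.all fun ch => !decide ((ch.1 : ℤ) ∣ evalInt ch.2.1 f.X)) &&
    decide ((normFormZ F.fs.base.a F.fs.base.b F.fs.base.c f.X.1 f.X.2.1 f.X.2.2).natAbs =
      (f.nf.map fun pe => pe.1 ^ pe.2).prod) &&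
    (f.nf.all fun pe => primeDispatchS3 F cc (fracOf F f.X f.tsn) f.X f.invsA f.miss2 pe.1) &&
    famKindCheckS3 F f

/-- `log ord_{W_j}`: `−1` for `q`, `−e` at the carrier of a generic element, `0` at the other two. -/
def famL3S (j : Fin 3) (f : FamEntryS3) : ℤ := if f.kind = 1 then -1 else if j = f.c then -(f.e : ℤ) else 0

/-- The norms of the family (`N(x) = N(X) / m₁³`). -/
def famNormS3 (j : Fin (famS3 cc).length) : ℤ :=
  normFormZ F.fs.base.a F.fs.base.b F.fs.base.c ((famS3 cc).get j).X.1 ((famS3 cc).get j).X.2.1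
    ((famS3 cc).get j).X.2.2 / (F.m₁ : ℤ) ^ 3

end Checkers

section CheckersR

variable (G : ClFieldCertRS2) (ccr : ClCurveCertS3R)

/-- **Family-entry checker (totally real, split `q`)**: the split-2 clause (`famCheckS3`, whose sign clause is the
one at `ρ₀`) and the sign clauses at `ρ₁`, `ρ₂`, all read on `X = m₁·x`. -/
def famCheckS3R (f : FamEntryS3) : Bool :=
  famCheckS3 G.toS2 ccr.cc f &&
    signCond G.fr.lo₂ G.fr.hi₂ f.X (ccr.sg₂ f.X) &&
    signCond G.fr.lo₃ G.fr.hi₃ f.X (ccr.sg₃ f.X)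

/-- Sign bit of the entry `f` at place `k`. -/
def sgAtS3 (f : FamEntryS3) (k : Fin 3) : Bool :=
  if k = 0 then f.sg else if k = 1 then ccr.sg₂ f.X else ccr.sg₃ f.X

/-- Row `k` of the parity matrix at the entry `f`: `0, 1, 2` the signs at `ρ₀, ρ₁, ρ₂`, `3, 4, 5` the parities of
`ord_{W_0}, ord_{W_1}, ord_{W_2}`, `6 + i` the Euler bit of the `i`-th residue character (all on `X`). -/
def bitRowRS3 (fc : ClFieldCert) (f : FamEntryS3) : ℕ → Bool
  | 0 => f.sg
  | 1 => ccr.sg₂ f.X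
  | 2 => ccr.sg₃ f.X
  | 3 => !decide ((2 : ℤ) ∣ famL3S 0 f)
  | 4 => !decide ((2 : ℤ) ∣ famL3S 1 f)
  | 5 => !decide ((2 : ℤ) ∣ famL3S 2 f)
  | k + 6 => eulerBit (fc.chars.getD k (3, 0, 0)).1 (evalInt (fc.chars.getD k (3, 0, 0)).2.1 f.X)

/-- The parity matrix. -/
def bitRS3 (k : Fin (G.toS2.fs.base.chars.length + 6)) (j : Fin (famS3 ccr.cc).length) : Bool :=
  bitRowRS3 ccr G.toS2.fs.base ((famS3 ccr.cc).get j) k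

/-- **The sieve** on pairs `(T, U)` (`T = ∅`): norm-square residues modulo `Q` and the three-real-place sign
conditions in `θ_E`-order (`admStd3RQ`, norms `N(X)/m₁³`), parities of `ord_{W_0}`, `ord_{W_1}`, `ord_{W_2}`. -/
def admRS3 (T : Finset (Fin 0)) (U : Finset (Fin (famS3 ccr.cc).length)) : Bool :=
  admStd3RQ ccr.cc.Q (fun i : Fin 0 => i.elim0) (famNormS3 G.toS2 ccr.cc) (fun i : Fin 0 => i.elim0)
      (fun i : Fin 0 => i.elim0) (fun i : Fin 0 => i.elim0)
      (fun j => sgAtS3 ccr ((famS3 ccr.cc).get j) ccr.o₀) (fun j => sgAtS3 ccr ((famS3 ccr.cc).get j) ccr.o₁)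
      (fun j => sgAtS3 ccr ((famS3 ccr.cc).get j) ccr.o₂) T U &&
    decide (Even (U.filter fun j => bitRowRS3 ccr G.toS2.fs.base ((famS3 ccr.cc).get j) 3 = true).card) &&
    decide (Even (U.filter fun j => bitRowRS3 ccr G.toS2.fs.base ((famS3 ccr.cc).get j) 4 = true).card) &&
    decide (Even (U.filter fun j => bitRowRS3 ccr G.toS2.fs.base ((famS3 ccr.cc).get j) 5 = true).card)

/-- **The core clauses of the totally real split-2 per-curve checker over a totally split `q`** — everything
except the survivor count: the clauses of the landed `checkRS` with THREE `invCert` data `X_D ∉ W_i`, a head of SIX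
field-level elements, the three-sign family clause, the `θ_E`-order of the places read on `X_t`, and the parity
certificate with `chars.length + 6` rows. Computable. -/
def checkRS3Core : Bool :=
  decide (deltaShort ccr.cc.A ccr.cc.B ccr.cc.C ≠ 0) &&
    noRootMod ccr.cc.pF ccr.cc.A ccr.cc.B ccr.cc.C &&
    decide (cubicAtCoords G.toS2.fs.base.a G.toS2.fs.base.b G.toS2.fs.base.c ((G.toS2.m₁ : ℤ) * ccr.cc.A)
      ((G.toS2.m₁ : ℤ) ^ 2 * ccr.cc.B) ((G.toS2.m₁ : ℤ) ^ 3 * ccr.cc.C) ccr.cc.Xt = (0, 0, 0)) &&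
    decide (derivAtCoords G.toS2.fs.base.a G.toS2.fs.base.b G.toS2.fs.base.c ((G.toS2.m₁ : ℤ) * ccr.cc.A)
      ((G.toS2.m₁ : ℤ) ^ 2 * ccr.cc.B) ccr.cc.Xt =
      MonicCubic.mulCoords G.toS2.fs.base.a G.toS2.fs.base.b G.toS2.fs.base.c
        (smulCoords (G.toS2.m₁ : ℤ) ccr.cc.XD)
        (prodPowCoords G.toS2.fs.base.a G.toS2.fs.base.b G.toS2.fs.base.c [])) &&
    (fracOf G.toS2 ccr.cc.Xt ccr.cc.tsnT).check G.toS2.fs.base.a G.toS2.fs.base.b G.toS2.fs.base.c &&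
    (fracOf G.toS2 ccr.cc.XD ccr.cc.tsnD).check G.toS2.fs.base.a G.toS2.fs.base.b G.toS2.fs.base.c &&
    decide (0 < MonicCubic.disc ccr.cc.A ccr.cc.B ccr.cc.C) &&
    decide (normFormZ G.toS2.fs.base.a G.toS2.fs.base.b G.toS2.fs.base.c ccr.cc.XD.1 ccr.cc.XD.2.1
      ccr.cc.XD.2.2 ≠ 0) &&
    decide ((normFormZ G.toS2.fs.base.a G.toS2.fs.base.b G.toS2.fs.base.c ccr.cc.XD.1 ccr.cc.XD.2.1
      ccr.cc.XD.2.2).natAbs = (ccr.cc.dn.map fun pe => pe.1 ^ pe.2).prod) &&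
    (ccr.cc.dn.all fun pe => primeDispatchS3 G.toS2 ccr.cc (fracOf G.toS2 ccr.cc.XD ccr.cc.tsnD) ccr.cc.XD
      ccr.cc.dinvA ccr.cc.dmiss2 pe.1) &&
    (ccr.cc.codes.all fun bc => codeClauseS3 G.toS2 ccr.cc bc) &&
    invCert G.toS2.fs.base.a G.toS2.fs.base.b G.toS2.fs.base.c (G.toS2.fs.base.wq 0) ccr.cc.XD ccr.cc.dW0 &&
    invCert G.toS2.fs.base.a G.toS2.fs.base.b G.toS2.fs.base.c (G.toS2.fs.base.wq 1) ccr.cc.XD ccr.cc.dW1 &&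
    invCert G.toS2.fs.base.a G.toS2.fs.base.b G.toS2.fs.base.c (G.toS2.fs.base.wq 2) ccr.cc.XD ccr.cc.dW2 &&
    (ccr.cc.Q.all fun q => decide (0 < q)) &&
    decide (ccr.cc.head.length = 6) &&
    ((famS3 ccr.cc).all fun f => famCheckS3R G ccr f) &&
    (linLtCond (G.fr.I ccr.o₀).1 (G.fr.I ccr.o₀).2 (G.fr.I ccr.o₁).1 (G.fr.I ccr.o₁).2 ccr.cc.Xt &&
      linLtCond (G.fr.I ccr.o₁).1 (G.fr.I ccr.o₁).2 (G.fr.I ccr.o₂).1 (G.fr.I ccr.o₂).2 ccr.cc.Xt) &&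
    decide (∀ T : Finset (Fin (famS3 ccr.cc).length), T ≠ ∅ →
      ∃ k : Fin (G.toS2.fs.base.chars.length + 6), Odd (T.filter fun j => bitRS3 G ccr k j = true).card)

end CheckersR

/-! ## Soundness: entry-level lemmas -/

section Sound

variable {K : Type*} [Field K] [NumberField K] {θ : K} {F : ClFieldCertS2} {cc : ClCurveCertS3} {f : FamEntryS3}

/-- The fractional element of a checked entry is integral. -/
theorem frac_of_famCheckS3 (h : famCheckS3 F cc f = true) :
    (fracOf F f.X f.tsn).check F.fs.base.a F.fs.base.b F.fs.base.c = true := by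
  simp only [famCheckS3, Bool.and_eq_true] at h
  exact h.1.1.1.1.1.1.1

/-- The sign clause at `ρ₀` of a checked entry. -/
theorem signCond_of_famCheckS3 (h : famCheckS3 F cc f = true) :
    signCond F.fs.base.lo F.fs.base.hi f.X f.sg = true := by
  simp only [famCheckS3, Bool.and_eq_true] at h
  exact h.1.1.1.1.1.1.2

variable {G : ClFieldCertRS2} {ccr : ClCurveCertS3R}

/-- The split-2 clause of a checked entry. -/
theorem famCheckS3_of_famCheckS3R (h : famCheckS3R G ccr f = true) : famCheckS3 G.toS2 ccr.cc f = true := by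
  simp only [famCheckS3R, Bool.and_eq_true] at h
  exact h.1.1

/-- **Sign bits at the three places** of a checked entry (`true` = negative). [folklore] -/
theorem sgAtS3_iff_of_famCheckS3R
    (hθ : aeval θ (MonicCubic.poly G.toS2.fs.base.a G.toS2.fs.base.b G.toS2.fs.base.c) = 0)
    (ρ : Fin 3 → (K →+* ℝ)) (h0 : ∀ k, 0 ≤ (G.fr.I k).1)
    (hρ : ∀ k, (((G.fr.I k).1 : ℚ) : ℝ) < ρ k θ ∧ ρ k θ < (((G.fr.I k).2 : ℚ) : ℝ))
    (hK : G.toS2.checkConst = true) (h : famCheckS3R G ccr f = true) (k : Fin 3) :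
    (sgAtS3 ccr f k = true ↔ ρ k (algebraMap (𝓞 K) K
      ((fracOf G.toS2 f.X f.tsn).toInt hθ (frac_of_famCheckS3 (famCheckS3_of_famCheckS3R h)))) < 0) := by
  have h1 := signCond_of_famCheckS3 (famCheckS3_of_famCheckS3R h)
  have hx := frac_of_famCheckS3 (famCheckS3_of_famCheckS3R h)
  have h' := h
  simp only [famCheckS3R, Bool.and_eq_true] at h'
  obtain ⟨⟨-, h2⟩, h3⟩ := h'
  have hk0 := h0 k
  obtain ⟨hlo, hhi⟩ := hρ k
  fin_cases k <;> simp only [ClFieldCertR.I, sgAtS3, Fin.isValue, Fin.zero_eta, Fin.mk_one, Fin.reduceFinMk,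
    ↓reduceIte, Fin.reduceEq] at hk0 hlo hhi ⊢
  · exact sign_iff_eltS_of_signCond hθ _ hk0 hlo hhi hK hx h1
  · exact sign_iff_eltS_of_signCond hθ _ hk0 hlo hhi hK hx h2
  · exact sign_iff_eltS_of_signCond hθ _ hk0 hlo hhi hK hx h3

/-- A checked entry does not vanish at any place. [folklore] -/
theorem rho_ne_zero_of_famCheckS3R
    (hθ : aeval θ (MonicCubic.poly G.toS2.fs.base.a G.toS2.fs.base.b G.toS2.fs.base.c) = 0)
    (ρ : Fin 3 → (K →+* ℝ)) (h0 : ∀ k, 0 ≤ (G.fr.I k).1)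
    (hρ : ∀ k, (((G.fr.I k).1 : ℚ) : ℝ) < ρ k θ ∧ ρ k θ < (((G.fr.I k).2 : ℚ) : ℝ))
    (h : famCheckS3R G ccr f = true) (k : Fin 3) :
    ρ k (algebraMap (𝓞 K) K
      ((fracOf G.toS2 f.X f.tsn).toInt hθ (frac_of_famCheckS3 (famCheckS3_of_famCheckS3R h)))) ≠ 0 := by
  have h1 := signCond_of_famCheckS3 (famCheckS3_of_famCheckS3R h)
  have hx := frac_of_famCheckS3 (famCheckS3_of_famCheckS3R h)
  have h' := h
  simp only [famCheckS3R, Bool.and_eq_true] at h'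
  obtain ⟨⟨-, h2⟩, h3⟩ := h'
  have hk0 := h0 k
  obtain ⟨hlo, hhi⟩ := hρ k
  fin_cases k <;> simp only [ClFieldCertR.I, Fin.isValue, Fin.zero_eta, Fin.mk_one, Fin.reduceFinMk,
    ↓reduceIte, Fin.reduceEq] at hk0 hlo hhi ⊢
  · exact rho_eltS_ne_zero_of_signCond hθ _ hk0 hlo hhi hx h1
  · exact rho_eltS_ne_zero_of_signCond hθ _ hk0 hlo hhi hx h2
  · exact rho_eltS_ne_zero_of_signCond hθ _ hk0 hlo hhi hx h3

end Sound

end Summit.BirchSwinnertonDyer.BirchSwinnertonDyer.Rank2Observatory.TwoDescCl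

end
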